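import Mathlib
import Literature.NumberTheory.Transcendental.KZHyperbolicLadder

/-!
# `OffTetraSectorKernel` (stmt-KontsevichZagierPeriods-10557), line `odd-hyperbolic-ladder`: rung zero is made of intervals

Stub `isGeodesicPolytope_zero_eq_interval`. Rung `n = 0` of Goncharov's hyperbolic scissors ladder is the
hyperbolic LINE `ℍ¹ = {t > 0} ⊂ (Fin 1 → ℝ)` with the volume density `1/t`. A `ℚ̄`-geodesic polytope of rung `0`
(`KZ.IsGeodesicPolytope 0 P`) is cut out of `{t > 0}` by finitely many constraints which, because the normal /
centre vectors have vanishing last (= only) coordinate, are either CONSTANT (`0 < -ε c`, a vertical "hyperplane"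
of the zero-dimensional boundary) or of the form `t² > c` / `t² < c` (a "hemisphere" centred at the boundary
point `0`), with `c` real algebraic. Finite volume (`1/t` integrable on `P`) forces, when `P ≠ ∅`, an upper
constraint (`1/t ∉ L¹(a, ∞)`) and a positive lower constraint (`1/t ∉ L¹(0, b)`), so `P` is the open interval
`{α < t < β}` with `α = √(max c) > 0`, `β = √(min c)` algebraic; the empty polytope is `{1 < t < 1}`.

This classification feeds the unconditional closing of rung `0` (volumes of rung-`0` polytopes are logarithms
`log (β/α)` of real algebraic numbers).

References: A. B. Goncharov, *Volumes of hyperbolic manifolds and mixed Tate motives* (1999), §1.1;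
M. Kontsevich, D. Zagier, *Periods* (2001), §1.1.
-/

noncomputable section

open Set MeasureTheory
open Literature.NumberTheory.Transcendental

namespace Summit.KontsevichZagierPeriods.HyperbolicBloch.OffTetraSectorKernel

/-- The rung-`0` hyperbolic density is `p ↦ (p 0)⁻¹` on `Fin 1 → ℝ`. [folklore] -/
theorem rungZero_hypDensity_eq : KZ.hypDensity 0 = fun p : Fin 1 → ℝ => (p 0)⁻¹ := by
  funext p
  simp [KZ.hypDensity]

/-- Transport of integrability of the rung-`0` density between the slab `{p | p 0 ∈ S} ⊆ ℝ¹` and `S ⊆ ℝ`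
(function `1/t`) along the measure-preserving equivalence `(Fin 1 → ℝ) ≃ᵐ ℝ`. [folklore] -/
theorem rungZero_integrableOn_hypDensity_iff (S : Set ℝ) :
    IntegrableOn (KZ.hypDensity 0) {p : Fin 1 → ℝ | p 0 ∈ S} ↔ IntegrableOn (fun t : ℝ => t⁻¹) S := by
  rw [rungZero_hypDensity_eq]
  -- adapted from `KZ.integrableOn_setOf_apply_mem_iff` (Literature/NumberTheory/Transcendental/KZBetaChains.lean)
  exact (volume_preserving_funUnique (Fin 1) ℝ).integrableOn_comp_preimage
    (MeasurableEquiv.funUnique (Fin 1) ℝ).measurableEmbedding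

/-- `1/t` has infinite integral on every right half-line `{a < t}` of `ℝ¹`: a rung-`0` polytope has no
infinite end at `∞`. [folklore] -/
theorem rungZero_not_integrableOn_Ioi (a : ℝ) :
    ¬ IntegrableOn (KZ.hypDensity 0) {p : Fin 1 → ℝ | a < p 0} := fun h =>
  not_integrableOn_Ioi_inv ((rungZero_integrableOn_hypDensity_iff (Ioi a)).1 h)

/-- `1/t` has infinite integral on every interval `{0 < t < b}` (`0 < b`) of `ℝ¹`: a rung-`0` polytope has no
infinite end at the boundary point `0`. [folklore] -/
theorem rungZero_not_integrableOn_Ioo {b : ℝ} (hb : 0 < b) :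
    ¬ IntegrableOn (KZ.hypDensity 0) {p : Fin 1 → ℝ | 0 < p 0 ∧ p 0 < b} := by
  intro h
  have h1 : IntegrableOn (fun t : ℝ => t⁻¹) (Ioo 0 b) := (rungZero_integrableOn_hypDensity_iff (Ioo 0 b)).1 h
  have h2 : IntervalIntegrable (fun t : ℝ => t⁻¹) volume 0 b := by
    rwa [intervalIntegrable_iff_integrableOn_Ioo_of_le hb.le]
  rw [intervalIntegrable_inv_iff] at h2
  rcases h2 with h2 | h2
  · exact hb.ne h2
  · exact h2 Set.left_mem_uIcc

/-- The square root of a real algebraic number is algebraic (for `c < 0` it is `0`). [folklore] -/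
theorem rungZero_isAlgebraic_sqrt {c : ℝ} (hc : IsAlgebraic ℚ c) : IsAlgebraic ℚ (Real.sqrt c) := by
  rcases le_or_gt 0 c with h | h
  · exact IsAlgebraic.of_pow two_pos (by rw [Real.sq_sqrt h]; exact hc)
  · rw [Real.sqrt_eq_zero'.2 h.le]
    exact isAlgebraic_zero

/-- **Rung `0` of the ladder is made of intervals.** Every finite-volume `ℚ̄`-geodesic polytope of the
hyperbolic line `{t > 0}` (density `1/t`) is an open interval `{α < t < β}` with real algebraic endpoints
`0 < α ≤ β` (`α = β` encodes the empty polytope): the constraints are constant or of the form `t² ≷ c`,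
and finiteness of `∫_P dt/t` forces a positive lower and a finite upper endpoint. [cite: Goncharov1999, §1.1] -/
theorem isGeodesicPolytope_zero_eq_interval : ∀ P : Set (Fin 1 → ℝ), Literature.NumberTheory.Transcendental.KZ.IsGeodesicPolytope 0 P → ∃ α β : ℝ, 0 < α ∧ α ≤ β ∧ IsAlgebraic ℚ α ∧ IsAlgebraic ℚ β ∧ P = {p : Fin 1 → ℝ | α < p 0 ∧ p 0 < β} := by
  rintro P ⟨k, flat, a, c, ε, -, hc, hε, ha0, hP, hint⟩
  -- all normal / centre vectors vanish (their only coordinate is the last one)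
  have ha : ∀ i l, a i l = 0 := fun i l => by
    rw [Fin.fin_one_eq_zero l, ← Fin.last_zero]
    exact ha0 i
  -- membership in `P` only depends on the height `t = p 0`: constant constraints and `t² ≷ c i`
  have hPQ : ∀ p : Fin 1 → ℝ, p ∈ P ↔
      0 < p 0 ∧ ∀ i, 0 < ε i * (if flat i then -c i else p 0 ^ 2 - c i) := by
    intro p
    rw [hP]
    simp only [mem_setOf_eq, Fin.last_zero, Fin.sum_univ_succ, Fin.sum_univ_zero, add_zero, ha, zero_mul,
      zero_sub, sub_zero]
  rcases P.eq_empty_or_nonempty with hPe | ⟨p₀, hp₀⟩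
  · -- the empty polytope is `{1 < t < 1}`
    refine ⟨1, 1, one_pos, le_rfl, isAlgebraic_one, isAlgebraic_one, ?_⟩
    rw [hPe]
    ext p
    simp only [mem_empty_iff_false, mem_setOf_eq, false_iff, not_and, not_lt]
    exact fun h => h.le
  -- nonempty case: a witness height `t₀`
  obtain ⟨ht₀, hQ₀⟩ := (hPQ p₀).1 hp₀
  -- candidate lower endpoints `√(c i)` (round constraints `t² > c i` with `c i > 0`) and upper endpoints
  -- `√(c i)` (round constraints `t² < c i`)
  obtain ⟨A, hA⟩ : ∃ A : Finset ℝ, ∀ x, x ∈ A ↔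
      ∃ i, (flat i = false ∧ ε i = 1 ∧ 0 < c i) ∧ Real.sqrt (c i) = x := by
    classical
    refine ⟨(Finset.univ.filter fun i => flat i = false ∧ ε i = 1 ∧ 0 < c i).image
      fun i => Real.sqrt (c i), fun x => ?_⟩
    simp only [Finset.mem_image, Finset.mem_filter, Finset.mem_univ, true_and]
  obtain ⟨B, hB⟩ : ∃ B : Finset ℝ, ∀ y, y ∈ B ↔
      ∃ i, (flat i = false ∧ ε i = -1) ∧ Real.sqrt (c i) = y := by
    classical
    refine ⟨(Finset.univ.filter fun i => flat i = false ∧ ε i = -1).image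
      fun i => Real.sqrt (c i), fun y => ?_⟩
    simp only [Finset.mem_image, Finset.mem_filter, Finset.mem_univ, true_and]
  -- for positive heights the constraints say exactly `A < t < B`
  have key : ∀ t : ℝ, 0 < t → ((∀ i, 0 < ε i * (if flat i then -c i else t ^ 2 - c i)) ↔
      (∀ x ∈ A, x < t) ∧ (∀ y ∈ B, t < y)) := by
    intro t ht
    constructor
    · intro hq
      refine ⟨fun x hx => ?_, fun y hy => ?_⟩
      · obtain ⟨i, ⟨hfi, hei, _⟩, rfl⟩ := (hA x).1 hx
        have h := hq i
        simp only [hfi, Bool.false_eq_true, ↓reduceIte, hei, one_mul, sub_pos] at h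
        exact (Real.sqrt_lt' ht).2 h
      · obtain ⟨i, ⟨hfi, hei⟩, rfl⟩ := (hB y).1 hy
        have h := hq i
        simp only [hfi, Bool.false_eq_true, ↓reduceIte, hei, neg_mul, one_mul, neg_sub, sub_pos] at h
        exact (Real.lt_sqrt ht.le).2 h
    · rintro ⟨h1, h2⟩ i
      have h₀ := hQ₀ i
      cases hfi : flat i
      · -- a round constraint `t² ≷ c i`
        simp only [Bool.false_eq_true, ↓reduceIte]
        rcases hε i with hei | hei
        · rw [hei, one_mul, sub_pos]
          rcases le_or_gt (c i) 0 with hci | hci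
          · exact hci.trans_lt (pow_pos ht 2)
          · exact (Real.sqrt_lt' ht).1 (h1 _ ((hA _).2 ⟨i, ⟨hfi, hei, hci⟩, rfl⟩))
        · rw [hei, neg_mul, one_mul, neg_sub, sub_pos]
          exact (Real.lt_sqrt ht.le).1 (h2 _ ((hB _).2 ⟨i, ⟨hfi, hei⟩, rfl⟩))
      · -- a constant constraint, witnessed by `t₀`
        rw [hfi] at h₀
        simpa using h₀
  obtain ⟨hA₀, hB₀⟩ := (key _ ht₀).1 hQ₀
  -- an upper constraint is present: otherwise `P ⊇ {t₀ < t}` has infinite volume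
  have hBne : B.Nonempty := by
    rw [Finset.nonempty_iff_ne_empty]
    intro hBe
    refine rungZero_not_integrableOn_Ioi (p₀ 0) (hint.mono_set fun p hp => ?_)
    have hp' : p₀ 0 < p 0 := hp
    exact (hPQ p).2 ⟨ht₀.trans hp', (key _ (ht₀.trans hp')).2
      ⟨fun x hx => (hA₀ x hx).trans hp', fun y hy => absurd hy (by simp [hBe])⟩⟩
  -- a positive lower constraint is present: otherwise `P ⊇ {0 < t < t₀}` has infinite volume
  have hAne : A.Nonempty := by
    rw [Finset.nonempty_iff_ne_empty]
    intro hAe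
    refine rungZero_not_integrableOn_Ioo ht₀ (hint.mono_set fun p hp => ?_)
    have hp' : 0 < p 0 ∧ p 0 < p₀ 0 := hp
    exact (hPQ p).2 ⟨hp'.1, (key _ hp'.1).2
      ⟨fun x hx => absurd hx (by simp [hAe]), fun y hy => hp'.2.trans (hB₀ y hy)⟩⟩
  have hαpos : 0 < A.max' hAne := by
    obtain ⟨i, ⟨-, -, hci⟩, hix⟩ := (hA _).1 (A.max'_mem hAne)
    rw [← hix]
    exact Real.sqrt_pos.2 hci
  refine ⟨A.max' hAne, B.min' hBne, hαpos, ?_, ?_, ?_, ?_⟩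
  · exact (((A.max'_lt_iff hAne).2 hA₀).trans ((B.lt_min'_iff hBne).2 hB₀)).le
  · obtain ⟨i, -, hix⟩ := (hA _).1 (A.max'_mem hAne)
    rw [← hix]
    exact rungZero_isAlgebraic_sqrt (hc i)
  · obtain ⟨i, -, hix⟩ := (hB _).1 (B.min'_mem hBne)
    rw [← hix]
    exact rungZero_isAlgebraic_sqrt (hc i)
  · ext p
    rw [hPQ p, mem_setOf_eq]
    constructor
    · rintro ⟨hp0, hq⟩
      obtain ⟨h1, h2⟩ := (key _ hp0).1 hq
      exact ⟨(A.max'_lt_iff hAne).2 h1, (B.lt_min'_iff hBne).2 h2⟩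
    · rintro ⟨h1, h2⟩
      have hp0 : 0 < p 0 := hαpos.trans h1
      exact ⟨hp0, (key _ hp0).2 ⟨(A.max'_lt_iff hAne).1 h1, (B.lt_min'_iff hBne).1 h2⟩⟩

end Summit.KontsevichZagierPeriods.HyperbolicBloch.OffTetraSectorKernel

end
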